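import Summits.PneNP.PneNP.Theorems.ChebyshevTracialDesignLevelTail
import Summits.PneNP.PneNP.Theorems.ChebyshevTracialDesignHighPartTail
import HarnessLib

/-!
# Cell pnp-psdrank, route `ChebyshevTracialDesign`: normalisations of the level classes — `|Q_c| = |PM|·N_c` and `λ₀(c) = |PM|·N_c²/C(n,t)`

Harmonic backbone of the crux `TracialDecayExp20` (stmt-PneNP-19878), brick 17 (bookkeeping). For `t = 2c'+1 ≤ n/2` and an odd level
`c = 2m+1` (`m ≤ c'`), with `N_c := T(n/2; c, c'−m) = C(n/2, c+c'−m)·C(c+c'−m, c'−m)·2^c` the (matching-independent) number of `t`-cuts at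
level `c` of a perfect matching (`…LevelAttenuation.level_colSum_eq`):
* `card_Qset_eq`: `|Q_c(t)| = |PM_n| · N_c`;
* `kernelEigen_level_zero_eq`: for every Gram class function `κ_c` of the level-`c` incidence, `C(n,t) · kernelEigen n t 0 κ_c = |PM_n| · N_c²`
  (`λ₀ = d_R·d_C` with `d_C = N_c`, `C(n,t)·d_R = |PM|·d_C`).
Hence the tail term of the r = 1 degree-truncation theorem (brick 16, `…RectangleTruncation`) reads
`|w_c|/|Q_c| · √(λ₀(κ_c)·B²·|X|·|Y|) = |w_c| · B · √(μ(X)·ν(Y))` with `μ = |X|/C(n,t)`, `ν = |Y|/|PM|` — the `B·√(μν)·ε` form of the route's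
(L2)/S3 tail (`tail_term_eq`). [cite: Rothvoss2017, §2 (PDF p. 6)] [cite: BrouwerHaemers2012, Thm. 4.9.1 (PDF p. 93)]
Stature: support/instrument. WHAT THIS IS NOT: bookkeeping only; nothing on psd rank, no P-vs-NP content. Supports stmt-PneNP-19878.
-/

set_option linter.dupNamespace false -- `Summit.PneNP.PneNP.…`: summit = sub-problem (D-0017)

noncomputable section

namespace Summit.PneNP.PneNP.Theorems.ChebyshevTracialDesignLevelNormalisation

open Finset Literature.Barriers.PneNP Literature.Combinatorics.Optimization
open Literature.Combinatorics.AssociationSchemes Literature.Combinatorics.AssociationSchemes.JohnsonHarmonics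
open Literature.Combinatorics.AssociationSchemes.JohnsonSpectrum
open Summit.PneNP.PneNP.Theorems.ChebyshevTracialDesignLevelAttenuation
open Summit.PneNP.PneNP.Theorems.ChebyshevTracialDesignHighPartTail

variable {n : ℕ}

/-- **`|Q_c(t)| = |PM_n| · N_c`** for `t = 2c'+1` and an odd level `c = 2m+1`, `m ≤ c'`, with `N_c = T(n/2; 2m+1, c'−m)`.
[cite: Rothvoss2017, §2 (PDF p. 6)] -/
theorem card_Qset_eq {c' m : ℕ} (hmc : m ≤ c') :
    ((Qset n (2 * c' + 1) (2 * m + 1)).card : ℝ) =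
      (Fintype.card (PMatch n) : ℝ) *
        (((n / 2).choose (2 * m + 1 + (c' - m)) * (2 * m + 1 + (c' - m)).choose (c' - m) * 2 ^ (2 * m + 1) : ℕ) : ℝ) := by
  classical
  have e1 : ((Qset n (2 * c' + 1) (2 * m + 1)).card : ℝ) =
      ∑ M : PMatch n, ∑ U : OddSet n, (if U.1.card = 2 * c' + 1 ∧ cc U M = 2 * m + 1 then (1 : ℝ) else 0) := by
    rw [Qset, Finset.card_filter, Nat.cast_sum, Fintype.sum_prod_type, sum_comm]
    refine sum_congr rfl fun M _ => sum_congr rfl fun U _ => ?_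
    split_ifs <;> simp
  have e2 : ∀ M : PMatch n, ∑ U : OddSet n, (if U.1.card = 2 * c' + 1 ∧ cc U M = 2 * m + 1 then (1 : ℝ) else 0) =
      (((n / 2).choose (2 * m + 1 + (c' - m)) * (2 * m + 1 + (c' - m)).choose (c' - m) * 2 ^ (2 * m + 1) : ℕ) : ℝ) := by
    intro M
    rw [sum_oddSet_level_eq_colSum ⟨c', rfl⟩ M (2 * m + 1) (fun _ => (1 : ℝ))]
    simp only [one_mul]
    exact level_colSum_eq ⟨m, rfl⟩ (by omega) M
  rw [e1, Fintype.sum_congr _ _ e2, sum_const, card_univ, nsmul_eq_mul]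

/-- **`C(n,t) · λ₀(κ_c) = |PM_n| · N_c²`**: for `t = 2c'+1 ≤ n/2`, an odd level `c = 2m+1` (`m ≤ c'`) and any Gram class function `κ_c` of the
level-`c` incidence on the `t`-sets, `C(n,t) · kernelEigen n t 0 κ_c = |PM_n| · N_c²` (`λ₀ = d_R d_C`, `d_C = N_c`, `C(n,t) d_R = |PM| d_C`).
[cite: BrouwerHaemers2012, Thm. 4.9.1 (PDF p. 93)] -/
theorem kernelEigen_level_zero_eq {c' m : ℕ} (ht : 2 * (2 * c' + 1) ≤ n) (hmc : m ≤ c') (κm : ℕ → ℝ)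
    (hAm : ∀ U ∈ univ.powersetCard (2 * c' + 1), ∀ U' ∈ univ.powersetCard (2 * c' + 1),
      ∑ M : PMatch n, (if (U.filter fun x => M.2.partner x ∉ U).card = 2 * m + 1 then (1 : ℝ) else 0) *
        (if (U'.filter fun x => M.2.partner x ∉ U').card = 2 * m + 1 then (1 : ℝ) else 0) = κm (U ∩ U').card) :
    (n.choose (2 * c' + 1) : ℝ) * kernelEigen n (2 * c' + 1) 0 κm =
      (Fintype.card (PMatch n) : ℝ) *
        (((n / 2).choose (2 * m + 1 + (c' - m)) * (2 * m + 1 + (c' - m)).choose (c' - m) * 2 ^ (2 * m + 1) : ℕ) : ℝ) ^ 2 := by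
  classical
  obtain ⟨U₁, hU₁⟩ : ∃ U : Finset (Fin n), U ∈ univ.powersetCard (2 * c' + 1) := by
    have : (univ.powersetCard (2 * c' + 1) : Finset (Finset (Fin n))).Nonempty := by
      apply powersetCard_nonempty.2; rw [card_univ, Fintype.card_fin]; omega
    exact this
  have hU₁t : U₁.card = 2 * c' + 1 := (mem_powersetCard.1 hU₁).2
  have hcol : ∀ M : PMatch n, ∑ U ∈ univ.powersetCard (2 * c' + 1),
      (if (U.filter fun x => M.2.partner x ∉ U).card = 2 * m + 1 then (1 : ℝ) else 0) =
      (((n / 2).choose (2 * m + 1 + (c' - m)) * (2 * m + 1 + (c' - m)).choose (c' - m) * 2 ^ (2 * m + 1) : ℕ) : ℝ) :=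
    fun M => level_colSum_eq ⟨m, rfl⟩ (by omega) M
  have hrow := fun U hU => level_rowSum_eq (t := 2 * c' + 1) (r := 2 * m + 1) κm hAm (U := U) hU
  have hl0 := kernelEigen_zero_eq_rowSum_mul_colSum _ κm hAm hcol hU₁t (hrow U₁ hU₁)
  have hh := choose_mul_rowSum_eq_card_mul_colSum _ hcol hrow
  rw [hl0, ← mul_assoc, hh]
  ring

/-- **The tail term in `μν` form**: with `|Q_c| = |PM|·N_c` and `C(n,t)·λ₀ = |PM|·N_c²`, for `B ≥ 0` and nonnegative `x, y`
(`= |X|, |Y|`): `(1/|Q_c|)·√(λ₀·B²·(y·x)) = B·√((x/C(n,t))·(y/|PM|))` — the `r = 1` tail of brick 16 is `Σ_c |w_c|·B_c·√(μν)`.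
[cite: Rothvoss2017, §2 (PDF p. 6)] -/
theorem tail_term_eq {Q l0 P N Cn B x y : ℝ} (hP : 0 < P) (hN : 0 < N) (hCn : 0 < Cn) (hB : 0 ≤ B) (hx : 0 ≤ x) (hy : 0 ≤ y)
    (hQ : Q = P * N) (hl0 : Cn * l0 = P * N ^ 2) :
    1 / Q * Real.sqrt (l0 * B ^ 2 * (y * x)) = B * Real.sqrt (x / Cn * (y / P)) := by
  have hl0' : l0 = P * N ^ 2 / Cn := by rw [← hl0]; field_simp
  have hQpos : 0 < Q := by rw [hQ]; positivity
  rw [hl0', hQ]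
  have h1 : P * N ^ 2 / Cn * B ^ 2 * (y * x) = (N * B) ^ 2 * (x / Cn * (y / P) * P ^ 2) := by
    field_simp
  rw [h1, Real.sqrt_mul (by positivity), Real.sqrt_sq (by positivity), Real.sqrt_mul (by positivity),
    Real.sqrt_sq hP.le]
  field_simp

end Summit.PneNP.PneNP.Theorems.ChebyshevTracialDesignLevelNormalisation
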